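import Summits.QuantumFields.YangMills.Theorems.PoincareLipschitzProjectionAveraging
import Mathlib.MeasureTheory.Integral.Average
import Mathlib.MeasureTheory.Integral.Prod
import HarnessLib

/-!
# Crux `HistoryTailL` (stmt-QuantumFields-19936 ∕ LINE 25 item stmt-QuantumFields-23533), S1″ row (C) `MinimisingMapCompactness`, (C)-PROOF brick
# (C-b-AVG) «CONTINUUM PROJECTION AVERAGING»: a weight DENSITY on any s-finite measure space, attached to points of the closed unit ball of `ℝ⁴`,
# admits a centre `p ∈ B_{1∕2}`, off any prescribed Lebesgue-null set, with `∫ c·‖q − p‖⁻² ≤ K·∫ c` — the Hardt–Kinderlehrer–Lin average,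
# continuum form (the finite form is ✓`PoincareLipschitzProjectionAveraging.exists_centre_weighted_le`)

Cell `ym3-torus` (YM ladder rung R3 = continuum SU(2) Yang–Mills on T³ — a RUNG, NOT the Clay problem: not d = 4, not infinite volume, not a mass
gap); width seat `ym3-torus-px22` g7.  Helper `--supports stmt-QuantumFields-23533`; THEOREMS ONLY (0 `def`, 0 `sorry`, default heartbeats),
Mathlib + ✓`…PoincareLipschitzProjectionAveraging` only.

WHY.  In the (C)-PROOF of `Literature.Analysis.PDE.MinimisingMapCompactness` (compactness of energy minimising maps `Q → S³`, by the
Hardt–Kinderlehrer–Lin route instead of Luckhaus' lemma) the non-unit interpolant `w = χv + (1 − χ)u` of two unit Sobolev maps is pushed back to the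
sphere by the ray projection `π_p` from a centre `p ∈ B_{1∕2} ⊂ ℝ⁴`; file H-1 (✓`…SphereRayProjection`) gives
`‖π_p(y) − π_p(z)‖² ≤ 36‖y − z‖²∕‖y − p‖²`, so the energy density of `π_p ∘ w` is `≤ 36·dens(∇w)∕‖w − p‖²`, and one needs ONE centre `p` for
which `∫_S dens(∇w)·‖w − p‖⁻²` is controlled by `∫_S dens(∇w)` — and which avoids a null set of bad centres (the at most countably many values
`w` takes on sets of positive measure, or any other Lebesgue-null obstruction).  This file supplies exactly that centre, for an ARBITRARY
nonnegative integrable weight `c` on a set `S` of an s-finite measure space and an a.e.-`B̄₁`-valued measurable `q`: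
Tonelli over `(B_{1∕2} ∖ N) × S`, the uniform bound `∫_{B_{1∕2}(0)} ‖q − p‖⁻² dp ≤ I₀ := ∫_{B_2(0)} ‖x‖⁻² dx` (`‖q‖ ≤ 1`; ✓H-2
`setIntegral_inv_norm_sub_sq_le`, `‖·‖⁻²` is integrable in dimension `4 > 2`), and the first-moment method (`exists_le_setLAverage`).

WHAT IS PROVED (ns `…Theorems.PoincareLipschitzProjectionAveragingContinuum`).
* §1 `setLIntegral_inv_norm_sub_sq_le` — the H-2 uniform bound in `ℝ≥0∞` form; `aemeasurable_kernel` — measurability of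
  `(p, x) ↦ c(x)·‖q(x) − p‖⁻²` on the product.
* §2 ★★★ `exists_centre_weightedIntegral_le_explicit` — for `(X, μ)` s-finite, `S ⊆ X`, `c` integrable on `S` and a.e. `≥ 0`, `q` a.e.-strongly
  measurable with `‖q‖ ≤ 1` a.e. on `S`, and `volume N = 0`: ∃ `p`, `‖p‖ < ½`, `p ∉ N`, `x ↦ c x·(‖q x − p‖²)⁻¹` integrable on `S` and
  `∫_S c·(‖q − p‖²)⁻¹ ∂μ ≤ K₀·∫_S c ∂μ` with the EXPLICIT constant `K₀ := I₀ ∕ |B_{1∕2}|`; ★★★ `exists_centre_weightedIntegral_le` — the same packaged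
  as `∃ K ≥ 0, ∀ …` (shape of the finite twin); `…_of_countable` — the countable-exceptional-set form.
HONEST SCOPE.  Measure-theoretic bookkeeping; NOTHING here proves (C) `MinimisingMapCompactness`, (RS), S1″, K1, `MeanDeviationL`,
`BlockLipschitzL` or `HistoryTailL`.  YM₃ on T³ is rung R3, not Clay; YM gap NOT proved; no summit statement is proved here.

References: R. Hardt, D. Kinderlehrer, F.-H. Lin, Comm. Math. Phys. 105 (1986) 547–570 [HardtKinderlehrerLin1986] (§2, the averaging device);
L. Simon, Theorems on Regularity and Singularity of Energy Minimizing Maps (1996), §2.9 (compactness, where the device is used for sphere targets).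
-/

set_option autoImplicit false

noncomputable section

open MeasureTheory Metric Set Function
open scoped BigOperators ENNReal

namespace Summit.QuantumFields.YangMills.Theorems.PoincareLipschitzProjectionAveragingContinuum

open Summit.QuantumFields.YangMills.Theorems.PoincareLipschitzProjectionAveraging

/-! ## §1 The uniform inner bound in `ℝ≥0∞` form and measurability of the kernel -/

/-- For `‖q‖ ≤ 1`: `p ↦ (‖q − p‖²)⁻¹` is integrable on `B_{1∕2}(0) ⊂ ℝ⁴` (it lies inside `B_2(q)`). [cite: HardtKinderlehrerLin1986, §2] -/
theorem integrableOn_inv_norm_sub_sq_halfBall (q : EuclideanSpace ℝ (Fin 4)) (hq : ‖q‖ ≤ 1) :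
    IntegrableOn (fun p : EuclideanSpace ℝ (Fin 4) => (‖q - p‖ ^ 2)⁻¹) (ball 0 (1 / 2)) volume := by
  refine (integrableOn_inv_norm_sub_sq_ball q 2).mono_set fun p hp => ?_
  rw [mem_ball_zero_iff] at hp
  rw [mem_ball, dist_eq_norm]
  calc ‖p - q‖ ≤ ‖p‖ + ‖q‖ := norm_sub_le _ _
    _ < 1 / 2 + 1 := by linarith
    _ ≤ 2 := by norm_num

/-- ★ The H-2 uniform bound in `ℝ≥0∞` currency: for `‖q‖ ≤ 1`,
`∫⁻_{B_{1∕2}(0)} ofReal((‖q − p‖²)⁻¹) dp ≤ ofReal(I₀)`, `I₀ := ∫_{B_2(0)} (‖x‖²)⁻¹ dx`. [cite: HardtKinderlehrerLin1986, §2] -/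
theorem setLIntegral_inv_norm_sub_sq_le (q : EuclideanSpace ℝ (Fin 4)) (hq : ‖q‖ ≤ 1) :
    ∫⁻ p in ball (0 : EuclideanSpace ℝ (Fin 4)) (1 / 2), ENNReal.ofReal ((‖q - p‖ ^ 2)⁻¹) ≤
      ENNReal.ofReal (∫ x in ball (0 : EuclideanSpace ℝ (Fin 4)) 2, (‖x‖ ^ 2)⁻¹) := by
  rw [← ofReal_integral_eq_lintegral_ofReal (integrableOn_inv_norm_sub_sq_halfBall q hq)
    (Filter.Eventually.of_forall fun p => by positivity)]
  exact ENNReal.ofReal_le_ofReal (setIntegral_inv_norm_sub_sq_le q hq)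

/-- Measurability of the kernel `(p, x) ↦ ofReal(c x)·ofReal((‖q x − p‖²)⁻¹)` on a product `ν × μ'` from a.e.-measurability of `c`, `q`
with respect to `μ'`. [folklore] -/
theorem aemeasurable_kernel {X : Type*} [MeasurableSpace X] {μ' : Measure X} [SFinite μ']
    (ν : Measure (EuclideanSpace ℝ (Fin 4))) {c : X → ℝ} {q : X → EuclideanSpace ℝ (Fin 4)}
    (hc : AEMeasurable c μ') (hq : AEMeasurable q μ') :
    AEMeasurable (uncurry fun (p : EuclideanSpace ℝ (Fin 4)) (x : X) =>
      ENNReal.ofReal (c x) * ENNReal.ofReal ((‖q x - p‖ ^ 2)⁻¹)) (ν.prod μ') := by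
  have h1 : AEMeasurable (fun z : EuclideanSpace ℝ (Fin 4) × X => c z.2) (ν.prod μ') := hc.comp_snd
  have h2 : AEMeasurable (fun z : EuclideanSpace ℝ (Fin 4) × X => q z.2) (ν.prod μ') := hq.comp_snd
  have h3 : AEMeasurable (fun z : EuclideanSpace ℝ (Fin 4) × X => z.1) (ν.prod μ') := measurable_fst.aemeasurable
  have h4 : AEMeasurable (fun z : EuclideanSpace ℝ (Fin 4) × X => (‖q z.2 - z.1‖ ^ 2)⁻¹) (ν.prod μ') :=
    ((h2.sub h3).norm.pow_const 2).inv
  exact h1.ennreal_ofReal.mul h4.ennreal_ofReal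

/-! ## §2 The averaged centre, continuum form -/

/-- ★★★ **HARDT–KINDERLEHRER–LIN AVERAGING, CONTINUUM FORM, EXPLICIT CONSTANT.**  Let `(X, μ)` be an s-finite measure space, `S ⊆ X`,
`c : X → ℝ` integrable on `S` and a.e. nonnegative there, `q : X → ℝ⁴` a.e.-strongly measurable with `‖q‖ ≤ 1` a.e. on `S`, and `N ⊂ ℝ⁴`
Lebesgue-null.  Then some centre `p` with `‖p‖ < ½`, `p ∉ N`, makes `x ↦ c x·(‖q x − p‖²)⁻¹` integrable on `S` with
`∫_S c·(‖q − p‖²)⁻¹ ∂μ ≤ K₀·∫_S c ∂μ`, `K₀ := (∫_{B_2(0)} (‖x‖²)⁻¹ dx) ∕ |B_{1∕2}(0)|` — some centre of `B_{1∕2} ∖ N` does at least as well as the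
average, and the average is bounded by Tonelli and `∫_{B_{1∕2}} ‖q − p‖⁻² dp ≤ I₀`. [cite: HardtKinderlehrerLin1986, §2] -/
theorem exists_centre_weightedIntegral_le_explicit {X : Type*} [MeasurableSpace X] (μ : Measure X) [SFinite μ]
    (S : Set X) (c : X → ℝ) (q : X → EuclideanSpace ℝ (Fin 4)) (N : Set (EuclideanSpace ℝ (Fin 4)))
    (hc : IntegrableOn c S μ) (hc0 : 0 ≤ᵐ[μ.restrict S] c) (hq : AEStronglyMeasurable q (μ.restrict S))
    (hq1 : ∀ᵐ x ∂(μ.restrict S), ‖q x‖ ≤ 1) (hN : volume N = 0) :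
    ∃ p : EuclideanSpace ℝ (Fin 4), ‖p‖ < 1 / 2 ∧ p ∉ N ∧
      IntegrableOn (fun x => c x * (‖q x - p‖ ^ 2)⁻¹) S μ ∧
      ∫ x in S, c x * (‖q x - p‖ ^ 2)⁻¹ ∂μ ≤
        (∫ x in ball (0 : EuclideanSpace ℝ (Fin 4)) 2, (‖x‖ ^ 2)⁻¹) / (volume (ball (0 : EuclideanSpace ℝ (Fin 4)) (1 / 2))).toReal *
          ∫ x in S, c x ∂μ := by
  set I₀ : ℝ := ∫ x in ball (0 : EuclideanSpace ℝ (Fin 4)) 2, (‖x‖ ^ 2)⁻¹ with hI₀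
  set B : Set (EuclideanSpace ℝ (Fin 4)) := ball 0 (1 / 2) with hB
  have hBpos : 0 < volume B := measure_ball_pos volume (0 : EuclideanSpace ℝ (Fin 4)) (by norm_num)
  have hBtop : volume B < ⊤ := measure_ball_lt_top
  have hV0 : 0 < (volume B).toReal := ENNReal.toReal_pos hBpos.ne' hBtop.ne
  have hI₀0 : 0 ≤ I₀ := setIntegral_nonneg measurableSet_ball fun x _ => by positivity
  have hCint : 0 ≤ ∫ x in S, c x ∂μ := setIntegral_nonneg_of_ae_restrict hc0
  -- the averaging set: the ball minus the null exceptional set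
  set s : Set (EuclideanSpace ℝ (Fin 4)) := B \ N with hs
  have hsvol : volume s = volume B := measure_sdiff_null hN
  have hs0 : volume s ≠ 0 := by rw [hsvol]; exact hBpos.ne'
  have hstop : volume s ≠ ⊤ := by rw [hsvol]; exact hBtop.ne
  have hsB : s ⊆ B := fun x hx => hx.1
  -- the measures and the kernel
  set μS : Measure X := μ.restrict S with hμS
  set ν : Measure (EuclideanSpace ℝ (Fin 4)) := volume.restrict s with hν
  set k : EuclideanSpace ℝ (Fin 4) → X → ℝ≥0∞ :=
    fun p x => ENNReal.ofReal (c x) * ENNReal.ofReal ((‖q x - p‖ ^ 2)⁻¹) with hk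
  have hcm : AEMeasurable c μS := hc.aestronglyMeasurable.aemeasurable
  have hqm : AEMeasurable q μS := hq.aemeasurable
  have hkm : AEMeasurable (uncurry k) (ν.prod μS) := aemeasurable_kernel ν hcm hqm
  -- Φ(p) := ∫⁻ k p x dμS is a.e.-measurable in p
  set Φ : EuclideanSpace ℝ (Fin 4) → ℝ≥0∞ := fun p => ∫⁻ x, k p x ∂μS with hΦ
  have hΦm : AEMeasurable Φ ν := hkm.lintegral_prod_right'
  -- Tonelli and the uniform inner bound: ∫⁻ Φ dν ≤ ofReal I₀ * ofReal (∫_S c)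
  have hinner : ∀ᵐ x ∂μS, ∫⁻ p, k p x ∂ν ≤ ENNReal.ofReal (c x) * ENNReal.ofReal I₀ := by
    filter_upwards [hq1] with x hx
    rw [hk]
    dsimp only
    rw [lintegral_const_mul' _ _ ENNReal.ofReal_ne_top]
    have hAC : ∫⁻ p, ENNReal.ofReal ((‖q x - p‖ ^ 2)⁻¹) ∂ν ≤ ENNReal.ofReal I₀ :=
      calc ∫⁻ p, ENNReal.ofReal ((‖q x - p‖ ^ 2)⁻¹) ∂ν
          ≤ ∫⁻ p in B, ENNReal.ofReal ((‖q x - p‖ ^ 2)⁻¹) := lintegral_mono' (Measure.restrict_mono hsB le_rfl) le_rfl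
        _ ≤ ENNReal.ofReal I₀ := setLIntegral_inv_norm_sub_sq_le (q x) hx
    exact mul_le_mul_of_nonneg_left hAC (zero_le)
  have hTon : ∫⁻ p, Φ p ∂ν ≤ ENNReal.ofReal I₀ * ENNReal.ofReal (∫ x in S, c x ∂μ) := by
    calc ∫⁻ p, Φ p ∂ν = ∫⁻ p, ∫⁻ x, k p x ∂μS ∂ν := rfl
      _ = ∫⁻ x, ∫⁻ p, k p x ∂ν ∂μS := lintegral_lintegral_swap hkm
      _ ≤ ∫⁻ x, ENNReal.ofReal (c x) * ENNReal.ofReal I₀ ∂μS := lintegral_mono_ae hinner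
      _ = (∫⁻ x, ENNReal.ofReal (c x) ∂μS) * ENNReal.ofReal I₀ := lintegral_mul_const'' _ hcm.ennreal_ofReal
      _ = ENNReal.ofReal (∫ x in S, c x ∂μ) * ENNReal.ofReal I₀ := by
          rw [ofReal_integral_eq_lintegral_ofReal hc hc0]
      _ = ENNReal.ofReal I₀ * ENNReal.ofReal (∫ x in S, c x ∂μ) := mul_comm _ _
  have hTon_top : ∫⁻ p, Φ p ∂ν ≠ ⊤ :=
    ne_top_of_le_ne_top (ENNReal.mul_ne_top ENNReal.ofReal_ne_top ENNReal.ofReal_ne_top) hTon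
  -- some centre of `s` is below the average
  obtain ⟨p, hps, hple⟩ := exists_le_setLAverage (μ := volume) (f := Φ) hs0 hstop hΦm
  have hΦp : Φ p ≤ (ENNReal.ofReal I₀ * ENNReal.ofReal (∫ x in S, c x ∂μ)) / volume B := by
    calc Φ p ≤ ⨍⁻ a in s, Φ a ∂volume := hple
      _ = (∫⁻ a in s, Φ a ∂volume) / volume s := setLAverage_eq _ _ _
      _ ≤ (ENNReal.ofReal I₀ * ENNReal.ofReal (∫ x in S, c x ∂μ)) / volume B := by
          rw [hsvol]; exact ENNReal.div_le_div_right hTon _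
  have hRHS_top : (ENNReal.ofReal I₀ * ENNReal.ofReal (∫ x in S, c x ∂μ)) / volume B ≠ ⊤ :=
    ENNReal.div_ne_top (ENNReal.mul_ne_top ENNReal.ofReal_ne_top ENNReal.ofReal_ne_top) hBpos.ne'
  have hΦp_top : Φ p < ⊤ := lt_of_le_of_lt hΦp hRHS_top.lt_top
  -- the real integrand at the chosen centre
  set g : X → ℝ := fun x => c x * (‖q x - p‖ ^ 2)⁻¹ with hg
  have hg0 : 0 ≤ᵐ[μS] g := by
    filter_upwards [hc0] with x hx
    exact mul_nonneg hx (by positivity)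
  have hgm : AEStronglyMeasurable g μS := by
    have h1 : AEMeasurable (fun x => (‖q x - p‖ ^ 2)⁻¹) μS := ((hqm.sub_const p).norm.pow_const 2).inv
    exact (hcm.mul h1).aestronglyMeasurable
  have hg_ofReal : ∀ᵐ x ∂μS, ENNReal.ofReal (g x) = k p x := by
    filter_upwards [hc0] with x hx
    rw [hg, hk]
    dsimp only
    rw [ENNReal.ofReal_mul hx]
  have hlint_g : ∫⁻ x, ENNReal.ofReal (g x) ∂μS = Φ p := lintegral_congr_ae hg_ofReal
  have hgint : Integrable g μS := by
    refine ⟨hgm, ?_⟩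
    rw [hasFiniteIntegral_iff_ofReal hg0, hlint_g]
    exact hΦp_top
  refine ⟨p, ?_, hps.2, hgint, ?_⟩
  · have := hsB hps; rwa [hB, mem_ball_zero_iff] at this
  · -- `∫ g = toReal (Φ p) ≤ toReal (ofReal I₀ * ofReal ∫c / |B|) = I₀ / |B| * ∫ c`
    have hint_eq : ∫ x in S, g x ∂μ = (Φ p).toReal := by
      rw [← hlint_g]; exact integral_eq_lintegral_of_nonneg_ae hg0 hgm
    calc ∫ x in S, c x * (‖q x - p‖ ^ 2)⁻¹ ∂μ = (Φ p).toReal := hint_eq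
      _ ≤ ((ENNReal.ofReal I₀ * ENNReal.ofReal (∫ x in S, c x ∂μ)) / volume B).toReal :=
          ENNReal.toReal_mono hRHS_top hΦp
      _ = I₀ * (∫ x in S, c x ∂μ) / (volume B).toReal := by
          rw [ENNReal.toReal_div, ENNReal.toReal_mul, ENNReal.toReal_ofReal hI₀0, ENNReal.toReal_ofReal hCint]
      _ = I₀ / (volume B).toReal * ∫ x in S, c x ∂μ := by ring

/-- The explicit constant `K₀ = I₀ ∕ |B_{1∕2}(0)|` is nonnegative. [folklore] -/
theorem averagingConst_nonneg :
    0 ≤ (∫ x in ball (0 : EuclideanSpace ℝ (Fin 4)) 2, (‖x‖ ^ 2)⁻¹) /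
      (volume (ball (0 : EuclideanSpace ℝ (Fin 4)) (1 / 2))).toReal :=
  div_nonneg (setIntegral_nonneg measurableSet_ball fun x _ => by positivity) ENNReal.toReal_nonneg

/-- ★★★ **HARDT–KINDERLEHRER–LIN AVERAGING, CONTINUUM FORM** (packaged like the finite twin ✓`exists_centre_weighted_le`): there is `K ≥ 0` such
that for every s-finite measure space `(X, μ)`, every `S ⊆ X`, every weight `c` integrable and a.e. nonnegative on `S`, every a.e.-strongly
measurable `q : X → ℝ⁴` with `‖q‖ ≤ 1` a.e. on `S`, and every Lebesgue-null `N ⊂ ℝ⁴`, some centre `p`, `‖p‖ < ½`, `p ∉ N`, has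
`x ↦ c x·(‖q x − p‖²)⁻¹` integrable on `S` and `∫_S c·(‖q − p‖²)⁻¹ ∂μ ≤ K·∫_S c ∂μ`. [cite: HardtKinderlehrerLin1986, §2] -/
theorem exists_centre_weightedIntegral_le.{u} : ∃ K : ℝ, 0 ≤ K ∧
    ∀ (X : Type u) [MeasurableSpace X] (μ : Measure X) [SFinite μ]
      (S : Set X) (c : X → ℝ) (q : X → EuclideanSpace ℝ (Fin 4)) (N : Set (EuclideanSpace ℝ (Fin 4))),
      IntegrableOn c S μ → 0 ≤ᵐ[μ.restrict S] c → AEStronglyMeasurable q (μ.restrict S) →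
      (∀ᵐ x ∂(μ.restrict S), ‖q x‖ ≤ 1) → volume N = 0 →
      ∃ p : EuclideanSpace ℝ (Fin 4), ‖p‖ < 1 / 2 ∧ p ∉ N ∧
        IntegrableOn (fun x => c x * (‖q x - p‖ ^ 2)⁻¹) S μ ∧
        ∫ x in S, c x * (‖q x - p‖ ^ 2)⁻¹ ∂μ ≤ K * ∫ x in S, c x ∂μ :=
  ⟨_, averagingConst_nonneg, fun _ _ μ _ S c q N hc hc0 hq hq1 hN =>
    exists_centre_weightedIntegral_le_explicit μ S c q N hc hc0 hq hq1 hN⟩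

/-- The countable-exceptional-set form (a countable set is Lebesgue-null): same conclusion with `N.Countable` in place of `volume N = 0`.
[cite: HardtKinderlehrerLin1986, §2] -/
theorem exists_centre_weightedIntegral_le_of_countable {X : Type*} [MeasurableSpace X] (μ : Measure X) [SFinite μ]
    (S : Set X) (c : X → ℝ) (q : X → EuclideanSpace ℝ (Fin 4)) (N : Set (EuclideanSpace ℝ (Fin 4)))
    (hc : IntegrableOn c S μ) (hc0 : 0 ≤ᵐ[μ.restrict S] c) (hq : AEStronglyMeasurable q (μ.restrict S))
    (hq1 : ∀ᵐ x ∂(μ.restrict S), ‖q x‖ ≤ 1) (hN : N.Countable) :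
    ∃ p : EuclideanSpace ℝ (Fin 4), ‖p‖ < 1 / 2 ∧ p ∉ N ∧
      IntegrableOn (fun x => c x * (‖q x - p‖ ^ 2)⁻¹) S μ ∧
      ∫ x in S, c x * (‖q x - p‖ ^ 2)⁻¹ ∂μ ≤
        (∫ x in ball (0 : EuclideanSpace ℝ (Fin 4)) 2, (‖x‖ ^ 2)⁻¹) / (volume (ball (0 : EuclideanSpace ℝ (Fin 4)) (1 / 2))).toReal *
          ∫ x in S, c x ∂μ :=
  exists_centre_weightedIntegral_le_explicit μ S c q N hc hc0 hq hq1 (hN.measure_zero volume)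

end Summit.QuantumFields.YangMills.Theorems.PoincareLipschitzProjectionAveragingContinuum

end
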